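import Mathlib.Analysis.SpecialFunctions.Complex.Log
import Mathlib.Algebra.Order.ToIntervalMod
import Literature.Analysis.Calculus.ClassGermThree

/-!
# The fibres of the torus class map: equal class data ⇒ same `S₃ ⋉ 2πℤ³`-orbit; nearby class data ⇒ nearby orbits

For `x ∈ ℝ³` let `cl x = (Σ_k e^{ix_k}, Σ_{j<k} e^{ix_j}e^{ix_k}, Π_k e^{ix_k}) ∈ ℂ³` (the characteristic data of
`diag(e^{ix_k})`).  We prove:
* `exists_perm_of_esymm_eq` — two triples in `ℂ` with the same elementary symmetric functions differ by a permutation;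
* `exists_perm_int_of_classData_eq` — `cl x = cl x₀ ⇒ x₀ k = x (σ k) + 2π n_k`;
* `exists_perm_int_near_of_classData_near` — **for every `x₀` and `δ > 0` there is `ε > 0` with: `dist (cl x) (cl x₀) < ε ⇒
  ‖(x (σ k) + 2π n_k)_k − x₀‖ < δ` for some `σ ∈ S₃`, `n ∈ ℤ³`** (compactness of the reduced cube and positivity of the
  distance off the orbit), and its `m`-place version `exists_perm_int_near_of_classPi_near`.
These are the topological facts that turn the germ models (★ `ClassGermThree`, ★ `ClassGermPi`) into statements about all
points with nearby class data [Glaeser1963Newton, §1], [Schwarz1975, §1].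
-/

noncomputable section

open Complex Set
open scoped Topology

namespace Literature.Analysis.Calculus

/-! ## §1 Equal symmetric functions ⇒ the triples differ by a permutation -/

/-- Core case: equal symmetric functions and equal first entries. [cite: Glaeser1963Newton, §1] -/
theorem exists_perm_of_esymm_eq_of_head_eq {l l' : Fin 3 → ℂ} (h0 : l' 0 = l 0) (h1 : l 0 + l 1 + l 2 = l' 0 + l' 1 + l' 2)
    (h2 : l 0 * l 1 + l 0 * l 2 + l 1 * l 2 = l' 0 * l' 1 + l' 0 * l' 2 + l' 1 * l' 2) :
    ∃ σ : Equiv.Perm (Fin 3), ∀ k, l' k = l (σ k) := by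
  have s : l 1 + l 2 = l' 1 + l' 2 := by linear_combination h1 + h0
  have p : l 1 * l 2 = l' 1 * l' 2 := by linear_combination h2 + (l' 1 + l' 2) * h0 - l 0 * s
  have hq : (l' 1 - l 1) * (l' 1 - l 2) = 0 := by linear_combination (-(l' 1)) * s + p
  rcases mul_eq_zero.1 hq with h | h
  · have e1 : l' 1 = l 1 := sub_eq_zero.1 h
    have e2 : l' 2 = l 2 := by linear_combination -s - e1
    exact ⟨1, fun k => by fin_cases k <;> simp [h0, e1, e2]⟩
  · have e1 : l' 1 = l 2 := sub_eq_zero.1 h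
    have e2 : l' 2 = l 1 := by linear_combination -s - e1
    exact ⟨Equiv.swap 1 2, fun k => by fin_cases k <;> simp [h0, e1, e2, Equiv.swap_apply_of_ne_of_ne]⟩

/-- **Two triples with the same elementary symmetric functions differ by a permutation of the slots.** [cite: Glaeser1963Newton, §1] -/
theorem exists_perm_of_esymm_eq {l l' : Fin 3 → ℂ} (h1 : l 0 + l 1 + l 2 = l' 0 + l' 1 + l' 2)
    (h2 : l 0 * l 1 + l 0 * l 2 + l 1 * l 2 = l' 0 * l' 1 + l' 0 * l' 2 + l' 1 * l' 2) (h3 : l 0 * l 1 * l 2 = l' 0 * l' 1 * l' 2) :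
    ∃ σ : Equiv.Perm (Fin 3), ∀ k, l' k = l (σ k) := by
  have hz : l' 0 ^ 3 - (l 0 + l 1 + l 2) * l' 0 ^ 2 + (l 0 * l 1 + l 0 * l 2 + l 1 * l 2) * l' 0 - l 0 * l 1 * l 2 = 0 := by
    rw [h1, h2, h3]; ring
  rcases eq_or_eq_or_eq_of_cubic_eq_zero (r₁ := l 0) (r₂ := l 1) (r₃ := l 2) rfl rfl rfl hz with h | h | h
  · exact exists_perm_of_esymm_eq_of_head_eq h h1 h2
  · obtain ⟨σ, hσ⟩ := exists_perm_of_esymm_eq_of_head_eq (l := l ∘ (⇑(Equiv.swap (0 : Fin 3) 1))) (l' := l')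
      (by simpa using h) (by simp only [Function.comp_apply, Equiv.swap_apply_left, Equiv.swap_apply_right,
        Equiv.swap_apply_of_ne_of_ne (show (2 : Fin 3) ≠ 0 by decide) (show (2 : Fin 3) ≠ 1 by decide)]; linear_combination h1)
      (by simp only [Function.comp_apply, Equiv.swap_apply_left, Equiv.swap_apply_right,
        Equiv.swap_apply_of_ne_of_ne (show (2 : Fin 3) ≠ 0 by decide) (show (2 : Fin 3) ≠ 1 by decide)]; linear_combination h2)
    exact ⟨Equiv.swap (0 : Fin 3) 1 * σ, fun k => by rw [Equiv.Perm.mul_apply]; exact hσ k⟩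
  · obtain ⟨σ, hσ⟩ := exists_perm_of_esymm_eq_of_head_eq (l := l ∘ (⇑(Equiv.swap (0 : Fin 3) 2))) (l' := l')
      (by simpa using h) (by simp only [Function.comp_apply, Equiv.swap_apply_left, Equiv.swap_apply_right,
        Equiv.swap_apply_of_ne_of_ne (show (1 : Fin 3) ≠ 0 by decide) (show (1 : Fin 3) ≠ 2 by decide)]; linear_combination h1)
      (by simp only [Function.comp_apply, Equiv.swap_apply_left, Equiv.swap_apply_right,
        Equiv.swap_apply_of_ne_of_ne (show (1 : Fin 3) ≠ 0 by decide) (show (1 : Fin 3) ≠ 2 by decide)]; linear_combination h2)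
    exact ⟨Equiv.swap (0 : Fin 3) 2 * σ, fun k => by rw [Equiv.Perm.mul_apply]; exact hσ k⟩

/-! ## §2 Equal class data ⇒ same `S₃ ⋉ 2πℤ³`-orbit; reduction modulo `2π` -/

/-- `e^{ia} = e^{ia'}` iff `a' = a + 2πn`. [cite: Dieudonne1960, Ch. IX §5] -/
theorem exists_int_of_cexp_mul_I_eq {a a' : ℝ} (h : Complex.exp ((a : ℂ) * I) = Complex.exp ((a' : ℂ) * I)) :
    ∃ n : ℤ, a' = a + 2 * Real.pi * n := by
  obtain ⟨n, hn⟩ := Complex.exp_eq_exp_iff_exists_int.1 h.symm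
  refine ⟨n, ?_⟩
  have := congrArg Complex.im hn
  simpa [mul_comm] using this

/-- `e^{i(a − 2πm)} = e^{ia}`. [cite: Dieudonne1960, Ch. IX §5] -/
theorem cexp_sub_two_pi_mul_int_mul_I (a : ℝ) (m : ℤ) :
    Complex.exp ((((a - 2 * Real.pi * m : ℝ)) : ℂ) * I) = Complex.exp ((a : ℂ) * I) :=
  Complex.exp_eq_exp_iff_exists_int.2 ⟨-m, by push_cast; ring⟩

/-- **Equal class data ⇒ the angle triples differ by a slot permutation and `2π`-shifts.** [cite: Glaeser1963Newton, §1] -/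
theorem exists_perm_int_of_classData_eq {x x₀ : Fin 3 → ℝ} (h : ((Complex.exp ((((x 0 : ℝ)) : ℂ) * I) + Complex.exp ((((x 1 : ℝ)) : ℂ) * I) + Complex.exp ((((x 2 : ℝ)) : ℂ) * I),
          Complex.exp ((((x 0 : ℝ)) : ℂ) * I) * Complex.exp ((((x 1 : ℝ)) : ℂ) * I) + Complex.exp ((((x 0 : ℝ)) : ℂ) * I) * Complex.exp ((((x 2 : ℝ)) : ℂ) * I) + Complex.exp ((((x 1 : ℝ)) : ℂ) * I) * Complex.exp ((((x 2 : ℝ)) : ℂ) * I),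
          Complex.exp ((((x 0 : ℝ)) : ℂ) * I) * Complex.exp ((((x 1 : ℝ)) : ℂ) * I) * Complex.exp ((((x 2 : ℝ)) : ℂ) * I)) : ℂ × ℂ × ℂ) = ((Complex.exp ((((x₀ 0 : ℝ)) : ℂ) * I) + Complex.exp ((((x₀ 1 : ℝ)) : ℂ) * I) + Complex.exp ((((x₀ 2 : ℝ)) : ℂ) * I),
          Complex.exp ((((x₀ 0 : ℝ)) : ℂ) * I) * Complex.exp ((((x₀ 1 : ℝ)) : ℂ) * I) + Complex.exp ((((x₀ 0 : ℝ)) : ℂ) * I) * Complex.exp ((((x₀ 2 : ℝ)) : ℂ) * I) + Complex.exp ((((x₀ 1 : ℝ)) : ℂ) * I) * Complex.exp ((((x₀ 2 : ℝ)) : ℂ) * I),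
          Complex.exp ((((x₀ 0 : ℝ)) : ℂ) * I) * Complex.exp ((((x₀ 1 : ℝ)) : ℂ) * I) * Complex.exp ((((x₀ 2 : ℝ)) : ℂ) * I)) : ℂ × ℂ × ℂ)) :
    ∃ (σ : Equiv.Perm (Fin 3)) (n : Fin 3 → ℤ), ∀ k, x₀ k = x (σ k) + 2 * Real.pi * n k := by
  obtain ⟨h1, h23⟩ := Prod.ext_iff.1 h
  obtain ⟨h2, h3⟩ := Prod.ext_iff.1 h23
  obtain ⟨σ, hσ⟩ := exists_perm_of_esymm_eq (l := fun k => Complex.exp (((x k : ℝ) : ℂ) * I)) (l' := fun k => Complex.exp (((x₀ k : ℝ) : ℂ) * I)) h1 h2 h3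
  have hn : ∀ k, ∃ n : ℤ, x₀ k = x (σ k) + 2 * Real.pi * n := fun k => exists_int_of_cexp_mul_I_eq (hσ k).symm
  choose n hn using hn
  exact ⟨σ, n, hn⟩

/-- Reduction modulo `2π` into the cube `‖·‖ ≤ π`. [cite: Dieudonne1960, Ch. IX §5] -/
theorem exists_int_norm_sub_le_pi (x : Fin 3 → ℝ) : ∃ m : Fin 3 → ℤ, ‖(fun k => x k - 2 * Real.pi * (m k : ℝ))‖ ≤ Real.pi := by
  refine ⟨fun k => toIocDiv Real.two_pi_pos (-Real.pi) (x k), (pi_norm_le_iff_of_nonneg Real.pi_pos.le).2 fun k => ?_⟩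
  have hmem := toIocMod_mem_Ioc Real.two_pi_pos (-Real.pi) (x k)
  have heq : x k - 2 * Real.pi * (toIocDiv Real.two_pi_pos (-Real.pi) (x k) : ℝ) = toIocMod Real.two_pi_pos (-Real.pi) (x k) := by
    rw [toIocMod, zsmul_eq_mul]; ring
  rw [Real.norm_eq_abs, heq, abs_le]
  constructor <;> linarith [hmem.1, hmem.2]

/-! ## §3 Nearby class data ⇒ nearby orbits -/

/-- **NEARBY CLASS DATA COME FROM NEARBY ORBIT POINTS.**  For every `x₀ ∈ ℝ³` and `δ > 0` there is `ε > 0` such that every `x` with `dist (cl x) (cl x₀) < ε` satisfies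
`‖(x (σ k) + 2π n_k)_k − x₀‖ < δ` for some slot permutation `σ` and `n ∈ ℤ³` (compactness of the reduced cube, ★ `exists_perm_int_of_classData_eq` on the zero set).
[cite: Glaeser1963Newton, §1] [cite: Schwarz1975, §1] [cite: Dieudonne1960, Ch. III §17] -/
theorem exists_perm_int_near_of_classData_near (x₀ : Fin 3 → ℝ) {δ : ℝ} (hδ : 0 < δ) :
    ∃ ε > (0 : ℝ), ∀ x : Fin 3 → ℝ, dist ((Complex.exp ((((x 0 : ℝ)) : ℂ) * I) + Complex.exp ((((x 1 : ℝ)) : ℂ) * I) + Complex.exp ((((x 2 : ℝ)) : ℂ) * I),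
          Complex.exp ((((x 0 : ℝ)) : ℂ) * I) * Complex.exp ((((x 1 : ℝ)) : ℂ) * I) + Complex.exp ((((x 0 : ℝ)) : ℂ) * I) * Complex.exp ((((x 2 : ℝ)) : ℂ) * I) + Complex.exp ((((x 1 : ℝ)) : ℂ) * I) * Complex.exp ((((x 2 : ℝ)) : ℂ) * I),
          Complex.exp ((((x 0 : ℝ)) : ℂ) * I) * Complex.exp ((((x 1 : ℝ)) : ℂ) * I) * Complex.exp ((((x 2 : ℝ)) : ℂ) * I)) : ℂ × ℂ × ℂ) ((Complex.exp ((((x₀ 0 : ℝ)) : ℂ) * I) + Complex.exp ((((x₀ 1 : ℝ)) : ℂ) * I) + Complex.exp ((((x₀ 2 : ℝ)) : ℂ) * I),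
          Complex.exp ((((x₀ 0 : ℝ)) : ℂ) * I) * Complex.exp ((((x₀ 1 : ℝ)) : ℂ) * I) + Complex.exp ((((x₀ 0 : ℝ)) : ℂ) * I) * Complex.exp ((((x₀ 2 : ℝ)) : ℂ) * I) + Complex.exp ((((x₀ 1 : ℝ)) : ℂ) * I) * Complex.exp ((((x₀ 2 : ℝ)) : ℂ) * I),
          Complex.exp ((((x₀ 0 : ℝ)) : ℂ) * I) * Complex.exp ((((x₀ 1 : ℝ)) : ℂ) * I) * Complex.exp ((((x₀ 2 : ℝ)) : ℂ) * I)) : ℂ × ℂ × ℂ) < ε →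
      ∃ (σ : Equiv.Perm (Fin 3)) (n : Fin 3 → ℤ), ‖(fun k => x (σ k) + 2 * Real.pi * (n k : ℝ)) - x₀‖ < δ := by
  set cl : (Fin 3 → ℝ) → ℂ × ℂ × ℂ := fun x => ((Complex.exp ((((x 0 : ℝ)) : ℂ) * I) + Complex.exp ((((x 1 : ℝ)) : ℂ) * I) + Complex.exp ((((x 2 : ℝ)) : ℂ) * I),
          Complex.exp ((((x 0 : ℝ)) : ℂ) * I) * Complex.exp ((((x 1 : ℝ)) : ℂ) * I) + Complex.exp ((((x 0 : ℝ)) : ℂ) * I) * Complex.exp ((((x 2 : ℝ)) : ℂ) * I) + Complex.exp ((((x 1 : ℝ)) : ℂ) * I) * Complex.exp ((((x 2 : ℝ)) : ℂ) * I),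
          Complex.exp ((((x 0 : ℝ)) : ℂ) * I) * Complex.exp ((((x 1 : ℝ)) : ℂ) * I) * Complex.exp ((((x 2 : ℝ)) : ℂ) * I)) : ℂ × ℂ × ℂ) with hcl
  show ∃ ε > (0 : ℝ), ∀ x : Fin 3 → ℝ, dist (cl x) (cl x₀) < ε →
      ∃ (σ : Equiv.Perm (Fin 3)) (n : Fin 3 → ℤ), ‖(fun k => x (σ k) + 2 * Real.pi * (n k : ℝ)) - x₀‖ < δ
  have hclc : Continuous cl := by rw [hcl]; fun_prop
  set φ : Equiv.Perm (Fin 3) → (Fin 3 → ℤ) → (Fin 3 → ℝ) → (Fin 3 → ℝ) := fun σ n x => fun k => x (σ k) + 2 * Real.pi * (n k : ℝ) with hφ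
  have hφc : ∀ σ n, Continuous (φ σ n) := by
    intro σ n
    rw [hφ]
    exact continuous_pi fun k => (continuous_apply (σ k)).add continuous_const
  set A : Set (Fin 3 → ℝ) := Metric.closedBall 0 Real.pi ∩ ⋂ σ, ⋂ n, {x | δ ≤ ‖φ σ n x - x₀‖} with hA
  have hAc : IsCompact A :=
    (isCompact_closedBall (0 : Fin 3 → ℝ) Real.pi).inter_right
      (isClosed_iInter fun σ => isClosed_iInter fun n => isClosed_le continuous_const (((hφc σ n).sub continuous_const).norm))
  have hpos : ∀ x ∈ A, 0 < dist (cl x) (cl x₀) := by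
    intro x hx
    rcases (dist_nonneg : 0 ≤ dist (cl x) (cl x₀)).eq_or_lt with h0 | h0
    · exfalso
      obtain ⟨σ, n, hσn⟩ := exists_perm_int_of_classData_eq (dist_eq_zero.1 h0.symm)
      have hmem : δ ≤ ‖φ σ n x - x₀‖ := Set.mem_iInter.1 (Set.mem_iInter.1 hx.2 σ) n
      have hφx : φ σ n x = x₀ := funext fun k => (hσn k).symm
      rw [hφx, sub_self, norm_zero] at hmem
      linarith
    · exact h0
  obtain ⟨ε, hε, hεA⟩ : ∃ ε > (0 : ℝ), ∀ x ∈ A, ε ≤ dist (cl x) (cl x₀) := by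
    rcases A.eq_empty_or_nonempty with hA0 | hAne
    · exact ⟨1, one_pos, fun x hx => by rw [hA0] at hx; exact absurd hx (Set.notMem_empty _)⟩
    · obtain ⟨x₁, hx₁, hmin⟩ := hAc.exists_isMinOn hAne (hclc.dist continuous_const).continuousOn
      exact ⟨_, hpos x₁ hx₁, fun x hx => (isMinOn_iff.1 hmin) x hx⟩
  refine ⟨ε, hε, fun x hx => ?_⟩
  obtain ⟨mI, hmI⟩ := exists_int_norm_sub_le_pi x
  set x' : Fin 3 → ℝ := fun k => x k - 2 * Real.pi * (mI k : ℝ) with hx'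
  have hk : ∀ k, Complex.exp (((x' k : ℝ) : ℂ) * I) = Complex.exp (((x k : ℝ) : ℂ) * I) := fun k => cexp_sub_two_pi_mul_int_mul_I (x k) (mI k)
  have hcl' : cl x' = cl x := by
    simp only [hcl]
    rw [hk 0, hk 1, hk 2]
  have hx'A : x' ∉ A := fun h => by
    have h' := hεA x' h
    rw [hcl'] at h'
    linarith
  have hx'B : x' ∈ Metric.closedBall (0 : Fin 3 → ℝ) Real.pi := by
    rw [Metric.mem_closedBall, dist_zero_right]; exact hmI
  have hnot : ¬ ∀ σ n, δ ≤ ‖φ σ n x' - x₀‖ := fun h =>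
    hx'A ⟨hx'B, Set.mem_iInter.2 fun σ => Set.mem_iInter.2 fun n => h σ n⟩
  push Not at hnot
  obtain ⟨σ, n, hlt⟩ := hnot
  refine ⟨σ, fun k => n k - mI (σ k), ?_⟩
  have hfun : (fun k => x (σ k) + 2 * Real.pi * ((n k - mI (σ k) : ℤ) : ℝ)) = φ σ n x' := by
    funext k
    simp only [hφ, hx']
    push_cast
    ring
  rw [hfun]
  exact hlt

/-! ## §4 The `m`-place version -/

/-- A finite family of positive reals has a positive lower bound. [cite: Dieudonne1960, Ch. III §17] -/
theorem exists_pos_forall_le {ι : Type*} [Fintype ι] (e : ι → ℝ) (he : ∀ i, 0 < e i) : ∃ ε > (0 : ℝ), ∀ i, ε ≤ e i := by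
  rcases isEmpty_or_nonempty ι with hι | hι
  · exact ⟨1, one_pos, fun i => isEmptyElim i⟩
  · refine ⟨Finset.univ.inf' Finset.univ_nonempty e, ?_, fun i => Finset.inf'_le _ (Finset.mem_univ i)⟩
    exact (Finset.lt_inf'_iff _).2 fun i _ => he i

/-- **NEARBY PLACE-WISE CLASS DATA COME FROM NEARBY ORBIT POINTS (`m` PLACES).** [cite: Glaeser1963Newton, §1] [cite: Schwarz1975, §1] -/
theorem exists_perm_int_near_of_classPi_near {m : ℕ} (x₀ : Fin m → Fin 3 → ℝ) {δ : ℝ} (hδ : 0 < δ) :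
    ∃ ε > (0 : ℝ), ∀ x : Fin m → Fin 3 → ℝ, dist (fun w => ((Complex.exp ((((x w 0 : ℝ)) : ℂ) * I) + Complex.exp ((((x w 1 : ℝ)) : ℂ) * I) + Complex.exp ((((x w 2 : ℝ)) : ℂ) * I),
          Complex.exp ((((x w 0 : ℝ)) : ℂ) * I) * Complex.exp ((((x w 1 : ℝ)) : ℂ) * I) + Complex.exp ((((x w 0 : ℝ)) : ℂ) * I) * Complex.exp ((((x w 2 : ℝ)) : ℂ) * I) + Complex.exp ((((x w 1 : ℝ)) : ℂ) * I) * Complex.exp ((((x w 2 : ℝ)) : ℂ) * I),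
          Complex.exp ((((x w 0 : ℝ)) : ℂ) * I) * Complex.exp ((((x w 1 : ℝ)) : ℂ) * I) * Complex.exp ((((x w 2 : ℝ)) : ℂ) * I)) : ℂ × ℂ × ℂ)) (fun w => ((Complex.exp ((((x₀ w 0 : ℝ)) : ℂ) * I) + Complex.exp ((((x₀ w 1 : ℝ)) : ℂ) * I) + Complex.exp ((((x₀ w 2 : ℝ)) : ℂ) * I),
          Complex.exp ((((x₀ w 0 : ℝ)) : ℂ) * I) * Complex.exp ((((x₀ w 1 : ℝ)) : ℂ) * I) + Complex.exp ((((x₀ w 0 : ℝ)) : ℂ) * I) * Complex.exp ((((x₀ w 2 : ℝ)) : ℂ) * I) + Complex.exp ((((x₀ w 1 : ℝ)) : ℂ) * I) * Complex.exp ((((x₀ w 2 : ℝ)) : ℂ) * I),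
          Complex.exp ((((x₀ w 0 : ℝ)) : ℂ) * I) * Complex.exp ((((x₀ w 1 : ℝ)) : ℂ) * I) * Complex.exp ((((x₀ w 2 : ℝ)) : ℂ) * I)) : ℂ × ℂ × ℂ)) < ε →
      ∃ (σ : Fin m → Equiv.Perm (Fin 3)) (n : Fin m → Fin 3 → ℤ), ‖(fun w k => x w (σ w k) + 2 * Real.pi * (n w k : ℝ)) - x₀‖ < δ := by
  have hw : ∀ w : Fin m, ∃ ε > (0 : ℝ), ∀ y : Fin 3 → ℝ, dist ((Complex.exp ((((y 0 : ℝ)) : ℂ) * I) + Complex.exp ((((y 1 : ℝ)) : ℂ) * I) + Complex.exp ((((y 2 : ℝ)) : ℂ) * I),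
          Complex.exp ((((y 0 : ℝ)) : ℂ) * I) * Complex.exp ((((y 1 : ℝ)) : ℂ) * I) + Complex.exp ((((y 0 : ℝ)) : ℂ) * I) * Complex.exp ((((y 2 : ℝ)) : ℂ) * I) + Complex.exp ((((y 1 : ℝ)) : ℂ) * I) * Complex.exp ((((y 2 : ℝ)) : ℂ) * I),
          Complex.exp ((((y 0 : ℝ)) : ℂ) * I) * Complex.exp ((((y 1 : ℝ)) : ℂ) * I) * Complex.exp ((((y 2 : ℝ)) : ℂ) * I)) : ℂ × ℂ × ℂ) ((Complex.exp ((((x₀ w 0 : ℝ)) : ℂ) * I) + Complex.exp ((((x₀ w 1 : ℝ)) : ℂ) * I) + Complex.exp ((((x₀ w 2 : ℝ)) : ℂ) * I),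
          Complex.exp ((((x₀ w 0 : ℝ)) : ℂ) * I) * Complex.exp ((((x₀ w 1 : ℝ)) : ℂ) * I) + Complex.exp ((((x₀ w 0 : ℝ)) : ℂ) * I) * Complex.exp ((((x₀ w 2 : ℝ)) : ℂ) * I) + Complex.exp ((((x₀ w 1 : ℝ)) : ℂ) * I) * Complex.exp ((((x₀ w 2 : ℝ)) : ℂ) * I),
          Complex.exp ((((x₀ w 0 : ℝ)) : ℂ) * I) * Complex.exp ((((x₀ w 1 : ℝ)) : ℂ) * I) * Complex.exp ((((x₀ w 2 : ℝ)) : ℂ) * I)) : ℂ × ℂ × ℂ) < ε →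
      ∃ (σ : Equiv.Perm (Fin 3)) (n : Fin 3 → ℤ), ‖(fun k => y (σ k) + 2 * Real.pi * (n k : ℝ)) - x₀ w‖ < δ :=
    fun w => exists_perm_int_near_of_classData_near (x₀ w) hδ
  choose e he hew using hw
  obtain ⟨ε, hε, hεe⟩ := exists_pos_forall_le e he
  refine ⟨ε, hε, fun x hx => ?_⟩
  have hxw : ∀ w, ∃ (σ : Equiv.Perm (Fin 3)) (n : Fin 3 → ℤ), ‖(fun k => x w (σ k) + 2 * Real.pi * (n k : ℝ)) - x₀ w‖ < δ := by
    intro w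
    refine hew w (x w) (lt_of_le_of_lt ?_ (lt_of_lt_of_le hx (hεe w)))
    exact dist_le_pi_dist ((fun w => ((Complex.exp ((((x w 0 : ℝ)) : ℂ) * I) + Complex.exp ((((x w 1 : ℝ)) : ℂ) * I) + Complex.exp ((((x w 2 : ℝ)) : ℂ) * I),
          Complex.exp ((((x w 0 : ℝ)) : ℂ) * I) * Complex.exp ((((x w 1 : ℝ)) : ℂ) * I) + Complex.exp ((((x w 0 : ℝ)) : ℂ) * I) * Complex.exp ((((x w 2 : ℝ)) : ℂ) * I) + Complex.exp ((((x w 1 : ℝ)) : ℂ) * I) * Complex.exp ((((x w 2 : ℝ)) : ℂ) * I),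
          Complex.exp ((((x w 0 : ℝ)) : ℂ) * I) * Complex.exp ((((x w 1 : ℝ)) : ℂ) * I) * Complex.exp ((((x w 2 : ℝ)) : ℂ) * I)) : ℂ × ℂ × ℂ))) ((fun w => ((Complex.exp ((((x₀ w 0 : ℝ)) : ℂ) * I) + Complex.exp ((((x₀ w 1 : ℝ)) : ℂ) * I) + Complex.exp ((((x₀ w 2 : ℝ)) : ℂ) * I),
          Complex.exp ((((x₀ w 0 : ℝ)) : ℂ) * I) * Complex.exp ((((x₀ w 1 : ℝ)) : ℂ) * I) + Complex.exp ((((x₀ w 0 : ℝ)) : ℂ) * I) * Complex.exp ((((x₀ w 2 : ℝ)) : ℂ) * I) + Complex.exp ((((x₀ w 1 : ℝ)) : ℂ) * I) * Complex.exp ((((x₀ w 2 : ℝ)) : ℂ) * I),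
          Complex.exp ((((x₀ w 0 : ℝ)) : ℂ) * I) * Complex.exp ((((x₀ w 1 : ℝ)) : ℂ) * I) * Complex.exp ((((x₀ w 2 : ℝ)) : ℂ) * I)) : ℂ × ℂ × ℂ))) w
  choose σ n hσn using hxw
  refine ⟨σ, n, (pi_norm_lt_iff hδ).2 fun w => ?_⟩
  exact hσn w

end Literature.Analysis.Calculus

end
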